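/-
Copyright (c) 2026 the pub-hodgecm-mathlib formalisation cell (harness21).  Prover seat hodgecm-mathlib-K2Liu-p02 (g6), Track B «K2-LIT» ∕ hLiu418
#184♮, Road I v3 for #42F′, wave «IK-GLOB» (LEAD F0P6-plan (g13) RULINGS «M-157q»∕«M-157r»), letter (K-b) «THE DOUBLED UNITARY GROUP IN STANDARD
DARBOUX COORDINATES» — the (K-a) letter instantiated at the doubled datum `ι^𝔻 = toSpD`.
-/
import Summits.HodgeConjecture.HodgeConjecture.Theorems.K2LiuResAutDarboux                  -- ★ (K-a) `darboux_resAut_eq_mulVec`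
import Literature.NumberTheory.GelbartRogawski1991.DoubledUnitaryGlobalSplittingData        -- ★ `toSpD`, `gramDA`, `isUnit_det_gramDA`, `HA`
import HarnessLib

/-!
# K2_Liu road (hLiu418 = stmt-HodgeConjecture-24832), wave «IK-GLOB», letter (K-b): the symplectic realisation `ι^𝔻(h) = toSpD h` of the doubled unitary
# group, read in the standard Darboux coordinates `u = (x, T^𝔻 y)` of ★ `transportSp`, is the block matrix `(P, d·Q·(T^𝔻)⁻¹; T^𝔻·Q, T^𝔻·P·(T^𝔻)⁻¹)`

Cell `pub/hodgecm-mathlib` (D-0151), Track B, build stream 29; DESIGN memo `K2/K2Liu-p02/g6/DESIGN-IKGLOB-WprimeKD.K2Liu-p02-g6.md` §2 (K), §4 (E).  ★ `toSpD` of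
`DoubledUnitaryGlobalSplittingData` is ★ `UnitaryGroup.adelicToSymplectic` at `N := n + n`, `T := T^𝔻 = gramD` (so `.1 = resAut` in the adelic quadratic coordinates
`𝔸_L = 𝔸_{L⁺} ⊕ 𝔸_{L⁺} δ`, `δ = imagUnit L`, ★ `isQuadraticCoordinates_adele`); the (K-a) letter ★ `K2LiuResAutDarboux.darboux_resAut_eq_mulVec` therefore gives
the standard-frame MATRIX of `ι^𝔻(h)` for EVERY `h ∈ H(𝔸)`: `P = re ∘ h`, `Q = im ∘ h` entrywise, `d = δ² ⊗ 1`, `T = T^𝔻 ⊗ 1 = gramDA`.  This is the `R` that ★ p859248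
`K2LiuCayleyMoverDeltaFrame.cayleyMoverMatrix_mul_eq_of_deltaStable` conjugates by the Cayley mover (after the re-enumeration `e₂ ⊕ e₂`, ★ `K2LiuCayleyMoverFin`) — the
bridge between the unitary side (`sD h`, ★ `IsDoubledWeilRep`) and the rational movers `r_F(γ)` (★ `rFD = ratThetaLiftCont`, projection `transportSp ∘ mapHom`) that
(K)∕(E) of IK-GLOB need.

* **`darboux_toSpD_eq_mulVec`** — `darboux T^𝔻 ((toSpD h).1 v) = (P, d • Q (T^𝔻)⁻¹; T^𝔻 Q, T^𝔻 P (T^𝔻)⁻¹) · darboux T^𝔻 v`.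

No definition, no instance, no notation, no named-fact hypothesis, no `sorry`; axioms ⊆ {propext, Classical.choice, Quot.sound}.  HONEST LABEL: HC_CM is proved only
modulo the 7 printed citations (2 remaining named inputs: hLiu418 = stmt-HodgeConjecture-24832, h413 = stmt-HodgeConjecture-24833) until rung 0 closes; this file is a
`--supports stmt-HodgeConjecture-24832` helper (wave IK-GLOB, letter (K-b)) and moves no counter.

References: [GelbartRogawski1991] S. Gelbart, J. Rogawski, Invent. Math. 105 (1991), §3.1 Prop. 3.1.1 p. 455; [Kudla1994] S. S. Kudla, Israel J. Math. 87 (1994), §2–§3;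
[MoeglinVignerasWaldspurger1987] LNM 1291, Chap. 2 II.2.
-/

set_option autoImplicit false
set_option linter.dupNamespace false

noncomputable section

open scoped Matrix
open NumberField IsDedekindDomain

namespace Summit.HodgeConjecture.HodgeConjecture.Cruxes.HLiu418.K2LiuDoubledDarbouxMatrix

open Literature.NumberTheory.Automorphic Literature.NumberTheory.Automorphic.UnitaryGroup
open Literature.NumberTheory.Automorphic.UnitaryGroup.QuadraticCoordinates
open Literature.RepresentationTheory.HeisenbergGroup Literature.RepresentationTheory.HeisenbergGroup.SymplecticMatrix
open Literature.NumberTheory.GelbartRogawski1991 Literature.NumberTheory.GelbartRogawski1991.GRConstruction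
open Literature.NumberTheory.GelbartRogawski1991.UnitaryDualPair
open Summit.HodgeConjecture.HodgeConjecture.Cruxes.HLiu418.K2LiuResAutDarboux (darboux_resAut_eq_mulVec)

variable (L : Type) [Field L] [NumberField L] [IsCMField L]
variable {N M n : ℕ} (e : Fin N × Fin M ≃ Fin n)
  (dV : Fin N → L) (hdV : ∀ i, IsCMField.complexConj L (dV i) = dV i) (hdV0 : ∀ i, dV i ≠ 0)
  (dW : Fin M → L) (hdW : ∀ i, IsCMField.complexConj L (dW i) = dW i) (hdW0 : ∀ i, dW i ≠ 0)

/-- **`ι^𝔻(h)` IN STANDARD DARBOUX COORDINATES.**  For every `h ∈ H(𝔸) = U(𝔻)(𝔸_{L⁺})`, with `P = re ∘ h`, `Q = im ∘ h` (entrywise adelic quadratic coordinates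
`𝔸_L = 𝔸_{L⁺} ⊕ 𝔸_{L⁺}·δ`, `δ = imagUnit L`), `d = δ² ⊗ 1` and `T^𝔻 = gramDA`:
`darboux T^𝔻 ((toSpD h).1 v) = (P, d • Q (T^𝔻)⁻¹; T^𝔻 Q, T^𝔻 P (T^𝔻)⁻¹) · darboux T^𝔻 v` (★ (K-a) at ★ `isQuadraticCoordinates_adele`; `toSpD = adelicToSymplectic`,
`.1 = resAut` definitionally). [cite: GelbartRogawski1991, §3.1 Prop. 3.1.1 p. 455 L1–2] [cite: Kudla1994, §2] -/
theorem darboux_toSpD_eq_mulVec (h : HA L e dV hdV dW hdW) (v : (Fin (n + n) → AdeleRing (𝓞 (Fp L)) (Fp L)) × (Fin (n + n) → AdeleRing (𝓞 (Fp L)) (Fp L))) :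
    SymplecticMatrix.darboux (gramDA L e dV hdV dW hdW) (isUnit_det_gramDA L e dV hdV hdV0 dW hdW hdW0) ((toSpD L e dV hdV dW hdW h).1 v) =
      Matrix.fromBlocks
          (((h : GL (Fin (n + n)) (AdeleRing (𝓞 L) L)) : Matrix (Fin (n + n)) (Fin (n + n)) (AdeleRing (𝓞 L) L)).map
            (re (quadraticAdeleEquiv (Fp L) L (IsCMField.complexConj L) (complexConj_imagUnit L) (imagUnit_ne_zero L)).toAddEquiv))
          (algebraMap (Fp L) (AdeleRing (𝓞 (Fp L)) (Fp L)) (imagUnitSq L) •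
            ((((h : GL (Fin (n + n)) (AdeleRing (𝓞 L) L)) : Matrix (Fin (n + n)) (Fin (n + n)) (AdeleRing (𝓞 L) L)).map
              (im (quadraticAdeleEquiv (Fp L) L (IsCMField.complexConj L) (complexConj_imagUnit L) (imagUnit_ne_zero L)).toAddEquiv)) *
              (gramDA L e dV hdV dW hdW)⁻¹))
          (gramDA L e dV hdV dW hdW *
            ((h : GL (Fin (n + n)) (AdeleRing (𝓞 L) L)) : Matrix (Fin (n + n)) (Fin (n + n)) (AdeleRing (𝓞 L) L)).map
              (im (quadraticAdeleEquiv (Fp L) L (IsCMField.complexConj L) (complexConj_imagUnit L) (imagUnit_ne_zero L)).toAddEquiv))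
          (gramDA L e dV hdV dW hdW *
            ((h : GL (Fin (n + n)) (AdeleRing (𝓞 L) L)) : Matrix (Fin (n + n)) (Fin (n + n)) (AdeleRing (𝓞 L) L)).map
              (re (quadraticAdeleEquiv (Fp L) L (IsCMField.complexConj L) (complexConj_imagUnit L) (imagUnit_ne_zero L)).toAddEquiv) *
            (gramDA L e dV hdV dW hdW)⁻¹) *ᵥ
        SymplecticMatrix.darboux (gramDA L e dV hdV dW hdW) (isUnit_det_gramDA L e dV hdV hdV0 dW hdW hdW0) v :=
  darboux_resAut_eq_mulVec
    (isQuadraticCoordinates_adele L (IsCMField.complexConj L) (complexConj_imagUnit L) (imagUnit_ne_zero L) (imagUnit_mul_self L))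
    (gramDA L e dV hdV dW hdW) (isUnit_det_gramDA L e dV hdV hdV0 dW hdW hdW0) (h : GL (Fin (n + n)) (AdeleRing (𝓞 L) L)) v

end Summit.HodgeConjecture.HodgeConjecture.Cruxes.HLiu418.K2LiuDoubledDarbouxMatrix

end
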